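import Mathlib
import Summits.Ventures.HodgeRepro2.T6N3SideRichToy
import Summits.Ventures.HodgeRepro2.T6N42RichSeam

/-!
# T6N42RichSeamToy — THE JOINT TOY OF THE SEAM (§10.5(ii)(c)/(d)): the N4.2 host instance shape
instantiated on t6-p3's toy rich side `N3RichToy.sideRich : N3SideRich ℂ Unit` (owner t6-p5; imports
t6-p3's T6N3SideRichToy and this seat's T6N42RichSeam)

`T6N42RichSeam.lean` types the N4.2 host instance shape on an actual N3 side `X : N3SideRich LG Gf`:
`N3SideRich.n42Rich X F hF S hS : N42Rich` for a first-lift side `F : X.FirstLiftSideOn` under its laws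
`hF` and host readings `S : X.HostReadingsOn D F hF` under theirs `hS`. Its install-hour item was a JOINT
toy: t6-p3's staged files then carried no toy `N3SideRich`. They do now (`T6N3SideRichToy.lean`, STATUS
l. 12623: `N3RichToy.sideRich` with `L²([H]) = ℂ`, `H(𝔸_f) = 1`, `R = id`, `π₀ = ⊤`, and the toy rich
datum `N3RichToy.toyRich` with both sides `sideRich`). This file is the kernel witness that the seam's
binder set instantiates SIMULTANEOUSLY with t6-p3's: the toy first-lift side `toyFirstLiftSide` of
`T6N42FlathLiftHost.lean` IS a first-lift side on `sideRich`'s carriers (`toySeamSide`, by `rfl` — the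
carriers of the toy rich side are exactly `ℂ`, `Unit`, `id`, `⊤`), the toy host readings
`toyHostReadings` are host readings on it (`toySeamReadings`), and

* `toyRichOfSeam := sideRich.n42Rich toySeamSide _ toySeamReadings _ : N42Rich` with
  `toyRichOfSeam_toDatum : toyRichOfSeam.toDatum = toyFinitePlaces` (`rfl`) and
  `toyRichOfSeam_eq_ofHost : toyRichOfSeam = toyRichOfHost` (`rfl`);
* on the toy rich DATUM: `toyRichOfSeamA := toyRich.n42RichA …`, `toyRichOfSeamB := toyRich.n42RichB …`
  (both with datum `toyFinitePlaces`, `rfl`);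
* `toyFinitePlaces_thetaNonzeroEverywhere_seam` — the toy's N4.2 conclusion re-derived THROUGH THE SEAM
  (`N3SideRich.thetaNonzeroEverywhere` on `sideRich` with the toy displays);
* **`toy_joint`** — on ONE toy, t6-p3's rich N3 conclusions (`N3RichToy.toyRich_N3A` / `_N3B`, the
  sixteen per-side Props + (i), (ii) discharged) and the N4.2 conclusion through the seam hold together:
  the binder set of the fourteen-file concatenation (t6-p3's STAGE 0 + this seat's N4.2 offer + the seam)
  is jointly satisfiable in kernel.

Nothing is consumed by any theorem of record; no display, no print (the two N4.2 displays enter only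
through the landed toy facts `toyTypeII_minguez` / `toyTower_ganIchino` of `T6N42Toy.lean`, as in
`T6N42RichHost.lean`). Proof lane (`abbrev`s, `def`s, `rfl` theorems and one conjunction).
README §8(d): uses an L-value-free non-vanishing device: NO (TIER5 §N4.2 / §B, pre-02:16Z lines of
record, continued).

Filed in Tier-6 WAVE 1 as p439141 (proposed 2026-08-26T10:49:00Z, ACCEPTED, commit c4cb07135f02);
this v2 differs from the filed bytes in this module docstring only (the staged-record wording
dropped; every declaration byte-identical to v1).
-/

namespace Summit.Ventures.HodgeRepro2.T6.N42Flath

open Summit.Ventures.HodgeRepro2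
open Summit.Ventures.HodgeRepro2.T6.N42Defs
open Summit.Ventures.HodgeRepro2.T6.N42Datum
open Summit.Ventures.HodgeRepro2.T6.N42Toy

/-- The toy first-lift side of `T6N42FlathLiftHost.lean` is a first-lift side on the carriers of t6-p3's
toy rich side (`sideRich.LH = ℂ`, `sideRich.Hf = Unit`, `sideRich.R = id`, `sideRich.π₀ = ⊤`, by `rfl`). -/
noncomputable abbrev toySeamSide : N3RichToy.sideRich.FirstLiftSideOn := toyFirstLiftSide

/-- … and it satisfies the laws (the toy laws). -/
theorem toySeamSide_isLift : toySeamSide.IsLift := toyFirstLiftSide_isLift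

/-- The toy host readings of `T6N42RichHost.lean` are host readings of the toy finite-places datum on the
toy rich side. -/
noncomputable abbrev toySeamReadings :
    N3RichToy.sideRich.HostReadingsOn toyFinitePlaces toySeamSide toySeamSide_isLift :=
  toyHostReadings

/-- … and they satisfy the laws (the toy laws). -/
theorem toySeamReadings_isReading : toySeamReadings.IsReading := toyHostReadings_isReading

/-- THE TOY RICH DATUM THROUGH THE SEAM: `N3SideRich.n42Rich` on t6-p3's toy rich side. -/
noncomputable def toyRichOfSeam : N42Rich :=
  N3RichToy.sideRich.n42Rich toySeamSide toySeamSide_isLift toySeamReadings toySeamReadings_isReading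

/-- Its datum is the toy finite-places datum (`rfl`). -/
theorem toyRichOfSeam_toDatum : toyRichOfSeam.toDatum = toyFinitePlaces := rfl

/-- Through the seam it is the host-shape toy of `T6N42RichHost.lean` (`rfl`). -/
theorem toyRichOfSeam_eq_ofHost : toyRichOfSeam = toyRichOfHost := rfl

/-- THE N4.2 RICH DATUM OF SIDE A OF THE TOY RICH DATUM (`N3DatumRich.n42RichA` on `N3RichToy.toyRich`). -/
noncomputable def toyRichOfSeamA : N42Rich :=
  N3RichToy.toyRich.n42RichA toySeamSide toySeamSide_isLift toySeamReadings toySeamReadings_isReading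

/-- THE N4.2 RICH DATUM OF SIDE B OF THE TOY RICH DATUM (`N3DatumRich.n42RichB` on `N3RichToy.toyRich`). -/
noncomputable def toyRichOfSeamB : N42Rich :=
  N3RichToy.toyRich.n42RichB toySeamSide toySeamSide_isLift toySeamReadings toySeamReadings_isReading

/-- Side A's datum is the toy finite-places datum (`rfl`). -/
theorem toyRichOfSeamA_toDatum : toyRichOfSeamA.toDatum = toyFinitePlaces := rfl

/-- Side B's datum is the toy finite-places datum (`rfl`). -/
theorem toyRichOfSeamB_toDatum : toyRichOfSeamB.toDatum = toyFinitePlaces := rfl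

/-- Both sides carry the same toy rich datum (`rfl`). -/
theorem toyRichOfSeamA_eq_B : toyRichOfSeamA = toyRichOfSeamB := rfl

/-- The toy's N4.2 conclusion re-derived THROUGH THE SEAM: `N3SideRich.thetaNonzeroEverywhere` on the toy
rich side with the two landed toy displays. -/
theorem toyFinitePlaces_thetaNonzeroEverywhere_seam : toyFinitePlaces.ThetaNonzeroEverywhere :=
  N3RichToy.sideRich.thetaNonzeroEverywhere toySeamSide toySeamSide_isLift toySeamReadings
    toySeamReadings_isReading (fun _ => toyTypeII_minguez) (fun _ => toyTower_ganIchino)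

/-- **THE JOINT TOY OF THE SEAM** (§10.5(ii)(d)): on t6-p3's toy rich datum, the rich N3 conclusions of
both sides (`N3RichToy.toyRich_N3A` / `toyRich_N3B`) and the N4.2 conclusion through the seam hold
simultaneously — the binder sets of t6-p3's STAGE 0, of this seat's N4.2 offer and of the seam are jointly
satisfiable in kernel. -/
theorem toy_joint :
    N3RichToy.toy.ellNonzero N3RichToy.toy.A ∧ N3RichToy.toy.ellNonzero N3RichToy.toy.B ∧
      toyFinitePlaces.ThetaNonzeroEverywhere :=
  ⟨N3RichToy.toyRich_N3A, N3RichToy.toyRich_N3B, toyFinitePlaces_thetaNonzeroEverywhere_seam⟩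

end Summit.Ventures.HodgeRepro2.T6.N42Flath
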